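import Summits.AtomisticToContinuum.Crystallization.Theorems.ExcessDecayLiouvillePhononStabilityCertCurvMono

/-!
# Near-certificate layer V6-a: the global model form and its slice concavity (lead c2, vertex scheme)

Support file for crux `PhononStability` (stmt-AtomisticToContinuum-9333), line `contragredient-window-collapse`.

The vertex scheme bounds the true finite-range quadratic form from below by ONE explicit function of the nine chart
variables, `Fmodel CL Aff Cq y w = Σ_{e ∈ CL} classModel_e(y)(w) + Σ_{(c,L) ∈ Aff} P_c(L(y))(w) − Σ_{(c,L) ∈ Cq} P_c(L(y))(w)`:
the class model terms (layer V5-b), AFFINE pair forms (the `−2κ` metric part in the affine metric model, constants) and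
subtracted CONVEX pair forms (the accumulated far charges, quadratic in the shift with positive semidefinite top
coefficient).  Along the slice of any variable `v` through a point of a box this is a slice sum of layer V5-a
(`Fmodel_update`), and with the curvature dominators of layers V5-c2/3 summed over the classes,
`M_v(w) = Σ_e P_{c_e}(W_{e,v})(w)` (`curvM`), the function `t ↦ Fmodel(y[v ↦ t]) − M_v(w)/2 · t²` is concave on the
slice (`concaveOn_Fmodel`).  The cell-independent side conditions are one `Bool` check on the data (`sliceShapeOK`);
the positivity of the `ρ`-intervals on the box is a hypothesis (discharged from a global check by monotonicity).
-/

noncomputable section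

open scoped BigOperators
open Set Function
open Summit.AtomisticToContinuum.Crystallization.Theorems.PhononStabilityNegative

namespace Summit.AtomisticToContinuum.Crystallization.Theorems.PhononStabilityCWC.Cert

local notation "E3" => EuclideanSpace ℝ (Fin 3)

/-- the data of one near class in the model: class, reference squared length, length polynomial, direction and metric
polynomial matrices, curvature frame and its inverse -/
structure ClassDat where
  /-- the bond class -/
  c : BondClass
  /-- reference squared length `ρ̄` -/
  ρbar : ℚ
  /-- `Δρ(y)` -/
  P : SPoly
  /-- `ζ̂ζ̂ᵀ(y)` -/
  Z : List (Mono × Mat)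
  /-- the affine metric model `Λ(y)` -/
  Λ : List (Mono × Mat)
  /-- curvature frame -/
  U : Mat
  /-- its inverse -/
  Uinv : Mat

/-- **THE GLOBAL MODEL FORM** of the vertex scheme. -/
def Fmodel (CL : List ClassDat) (Aff Cq : List (BondClass × List (Mono × Mat))) (y : ℕ → ℝ) (w : Label → E3) : ℝ :=
  (CL.map fun e => classModel e.ρbar e.P e.Z e.Λ e.c y w).sum + (Aff.map fun a => pairEvalR a.1 (matVal y a.2) w).sum
    - (Cq.map fun a => pairEvalR a.1 (matVal y a.2) w).sum

/-! ## Data checks -/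

/-- exact rational positive-semidefiniteness test of a symmetric `3 × 3` matrix (`LDLᵀ` pivots with the degenerate
cases handled) -/
def psd3 (M : Mat) : Bool :=
  -- exact rational LDLᵀ with symmetric input required
  decide (∀ i j, M i j = M j i) &&
  (let a := M 0 0
   let b := M 0 1
   let c := M 0 2
   let d := M 1 1
   let e := M 1 2
   let f := M 2 2
   if a < 0 then false
   else if a = 0 then
     -- first row/column must vanish; then the 2×2 block
     decide (b = 0 ∧ c = 0) && (if d < 0 then false else if d = 0 then decide (e = 0 ∧ 0 ≤ f) else decide (0 ≤ f - e * e / d))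
   else
     let d' := d - b * b / a
     let e' := e - b * c / a
     let f' := f - c * c / a
     if d' < 0 then false
     else if d' = 0 then decide (e' = 0 ∧ 0 ≤ f')
     else decide (0 ≤ f' - e' * e' / d'))

/-- soundness of `psd3`. [folklore] -/
theorem psd3_sound {M : Mat} (h : psd3 M = true) (u : Fin 3 → ℝ) : 0 ≤ bilR (fun i j => (M i j : ℝ)) u u := by
  unfold psd3 at h
  simp only [Bool.and_eq_true, decide_eq_true_eq] at h
  obtain ⟨hsym, h⟩ := h
  have hs10 : (M 1 0 : ℝ) = M 0 1 := by exact_mod_cast hsym 1 0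
  have hs20 : (M 2 0 : ℝ) = M 0 2 := by exact_mod_cast hsym 2 0
  have hs21 : (M 2 1 : ℝ) = M 1 2 := by exact_mod_cast hsym 2 1
  have hq : bilR (fun i j => (M i j : ℝ)) u u = (M 0 0 : ℝ) * u 0 ^ 2 + (M 1 1 : ℝ) * u 1 ^ 2 + (M 2 2 : ℝ) * u 2 ^ 2
      + 2 * (M 0 1 : ℝ) * u 0 * u 1 + 2 * (M 0 2 : ℝ) * u 0 * u 2 + 2 * (M 1 2 : ℝ) * u 1 * u 2 := by
    simp only [bilR, Fin.sum_univ_three, hs10, hs20, hs21]; ring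
  rw [hq]
  set a := M 0 0; set b := M 0 1; set c := M 0 2; set d := M 1 1; set e := M 1 2; set f := M 2 2
  split at h
  · exact absurd h (by simp)
  · rename_i hna
    split at h
    · rename_i ha0
      simp only [Bool.and_eq_true, decide_eq_true_eq] at h
      obtain ⟨⟨hb, hc⟩, h⟩ := h
      have ha0' : (a : ℝ) = 0 := by exact_mod_cast ha0
      have hb' : (b : ℝ) = 0 := by exact_mod_cast hb
      have hc' : (c : ℝ) = 0 := by exact_mod_cast hc
      rw [ha0', hb', hc']
      split at h
      · exact absurd h (by simp)
      · rename_i hnd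
        split at h
        · rename_i hd0
          simp only [decide_eq_true_eq] at h
          have hd0' : (d : ℝ) = 0 := by exact_mod_cast hd0
          have he' : (e : ℝ) = 0 := by exact_mod_cast h.1
          have hf' : (0 : ℝ) ≤ f := by exact_mod_cast h.2
          rw [hd0', he']; nlinarith [sq_nonneg (u 2)]
        · rename_i hd0
          simp only [decide_eq_true_eq] at h
          have hdpos : (0 : ℝ) < d := by
            have : 0 < d := lt_of_le_of_ne (not_lt.mp hnd) (Ne.symm hd0)
            exact_mod_cast this
          have hf' : (0 : ℝ) ≤ f - e * e / d := by exact_mod_cast h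
          have key : (d : ℝ) * u 1 ^ 2 + (f : ℝ) * u 2 ^ 2 + 2 * (e : ℝ) * u 1 * u 2
              = d * (u 1 + e / d * u 2) ^ 2 + (f - e * e / d) * u 2 ^ 2 := by
            field_simp; ring
          nlinarith [sq_nonneg (u 1 + e / d * u 2), sq_nonneg (u 2), mul_nonneg hdpos.le (sq_nonneg (u 1 + e / d * u 2)),
            mul_nonneg hf' (sq_nonneg (u 2))]
    · rename_i ha0
      have hapos : (0 : ℝ) < a := by
        have : 0 < a := lt_of_le_of_ne (not_lt.mp hna) (Ne.symm ha0)
        exact_mod_cast this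
      -- complete the square in `u 0`
      have key : (a : ℝ) * u 0 ^ 2 + (d : ℝ) * u 1 ^ 2 + (f : ℝ) * u 2 ^ 2 + 2 * (b : ℝ) * u 0 * u 1 + 2 * (c : ℝ) * u 0 * u 2
          + 2 * (e : ℝ) * u 1 * u 2
          = a * (u 0 + b / a * u 1 + c / a * u 2) ^ 2 + ((d - b * b / a) * u 1 ^ 2 + (f - c * c / a) * u 2 ^ 2
            + 2 * (e - b * c / a) * u 1 * u 2) := by
        field_simp; ring
      rw [key]
      have h1 : 0 ≤ (a : ℝ) * (u 0 + b / a * u 1 + c / a * u 2) ^ 2 := mul_nonneg hapos.le (sq_nonneg _)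
      suffices h2 : 0 ≤ ((d - b * b / a : ℚ) : ℝ) * u 1 ^ 2 + ((f - c * c / a : ℚ) : ℝ) * u 2 ^ 2
          + 2 * ((e - b * c / a : ℚ) : ℝ) * u 1 * u 2 by
        push_cast at h2; linarith
      set d' := d - b * b / a; set e' := e - b * c / a; set f' := f - c * c / a
      split at h
      · exact absurd h (by simp)
      · rename_i hnd
        split at h
        · rename_i hd0
          simp only [decide_eq_true_eq] at h
          have hd0' : (d' : ℝ) = 0 := by exact_mod_cast hd0
          have he' : (e' : ℝ) = 0 := by exact_mod_cast h.1
          have hf' : (0 : ℝ) ≤ f' := by exact_mod_cast h.2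
          rw [hd0', he']; nlinarith [sq_nonneg (u 2)]
        · rename_i hd0
          simp only [decide_eq_true_eq] at h
          have hdpos : (0 : ℝ) < d' := by
            have : 0 < d' := lt_of_le_of_ne (not_lt.mp hnd) (Ne.symm hd0)
            exact_mod_cast this
          have hf' : (0 : ℝ) ≤ f' - e' * e' / d' := by exact_mod_cast h
          have key2 : (d' : ℝ) * u 1 ^ 2 + (f' : ℝ) * u 2 ^ 2 + 2 * (e' : ℝ) * u 1 * u 2
              = d' * (u 1 + e' / d' * u 2) ^ 2 + (f' - e' * e' / d') * u 2 ^ 2 := by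
            field_simp; ring
          nlinarith [mul_nonneg hdpos.le (sq_nonneg (u 1 + e' / d' * u 2)), mul_nonneg hf' (sq_nonneg (u 2))]

/-- all monomials empty (a constant polynomial matrix, possibly as several summands) -/
def mpAllEmpty (L : List (Mono × Mat)) : Bool := L.all fun e => decide (e.1 = [])

/-- the sum of the coefficient matrices -/
def mpSum (L : List (Mono × Mat)) : Mat := fun i j => (L.map fun e => e.2 i j).sum

/-- a constant polynomial matrix evaluates to the sum of its matrices. [folklore] -/
theorem matVal_of_allEmpty {L : List (Mono × Mat)} (h : mpAllEmpty L = true) (x : ℕ → ℝ) (i j : Fin 3) :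
    matVal x L i j = (mpSum L i j : ℝ) := by
  induction L with
  | nil => simp [matVal, mpSum]
  | cons e L ih =>
      have h' : mpAllEmpty L = true := by
        simp only [mpAllEmpty, List.all_cons, Bool.and_eq_true] at h ⊢; exact h.2
      have he : e.1 = [] := by
        simp only [mpAllEmpty, List.all_cons, Bool.and_eq_true, decide_eq_true_eq] at h; exact h.1
      rw [matVal_cons, ih h', he]
      simp [mpSum, monoVal]

/-- the (cell-independent) slice-shape check for variable `v`: degrees `≤ 2` (classes, convex part), `≤ 1` (affine
part), frames invert, convex top coefficients constant and positive semidefinite -/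
def sliceShapeOK (CL : List ClassDat) (Aff Cq : List (BondClass × List (Mono × Mat))) (v : ℕ) : Bool :=
  (CL.all fun e => spDegLe e.P v 2 && mpDegLe e.Z v 2 && mpDegLe e.Λ v 2 && matEqB (mmul e.U e.Uinv) oneQ)
  && (Aff.all fun a => mpDegLe a.2 v 1)
  && (Cq.all fun a => mpDegLe a.2 v 2 && mpAllEmpty (mpCoeff a.2 v 2) && psd3 (mpSum (mpCoeff a.2 v 2)))

/-- degree `≤ 1` implies degree `≤ 2`. [folklore] -/
theorem mpDegLe_one_two {L : List (Mono × Mat)} {v : ℕ} (h : mpDegLe L v 1 = true) : mpDegLe L v 2 = true := by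
  unfold mpDegLe at *
  rw [List.all_eq_true] at *
  intro e he
  have := h e he
  simp only [decide_eq_true_eq] at this ⊢
  omega

/-- degree `≤ 1`: the `t²` coefficient vanishes. [folklore] -/
theorem mpCoeff_two_of_degLe_one {L : List (Mono × Mat)} {v : ℕ} (h : mpDegLe L v 1 = true) : mpCoeff L v 2 = [] := by
  unfold mpCoeff
  rw [List.map_eq_nil_iff, List.filter_eq_nil_iff]
  intro e he
  unfold mpDegLe at h
  rw [List.all_eq_true] at h
  have := h e he
  simp only [decide_eq_true_eq] at this
  simp only [decide_eq_true_eq]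
  omega

/-! ## The curvature bound of the model form along a variable -/

/-- **`M_v(w) = Σ_e P_{c_e}(W_{e,v}(B))(w)`**, the slice-curvature bound of the model form on the box `B`. -/
def curvM (CL : List ClassDat) (B : Box) (v : ℕ) (w : Label → E3) : ℝ :=
  (CL.map fun e => pairEvalR e.c (fun i j => (curvW (curvD e.ρbar e.P e.Z e.Λ v e.U B) e.Uinv i j : ℝ)) w).sum

/-- `curvM ≥ 0`. [folklore] -/
theorem curvM_nonneg (CL : List ClassDat) (B : Box) (v : ℕ) (w : Label → E3) : 0 ≤ curvM CL B v w := by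
  unfold curvM
  refine List.sum_nonneg ?_
  intro r hr
  rw [List.mem_map] at hr
  obtain ⟨e, -, rfl⟩ := hr
  exact pairEvalR_nonneg_of_psd e.c (curvW_psd (curvD_nonneg e.ρbar e.P e.Z e.Λ v e.U B) e.Uinv) w

/-- **`curvM` is inclusion monotone in the box** (node sharing). [folklore] -/
theorem curvM_mono {w : Label → E3} (hw : (support w).Finite) (CL : List ClassDat) {B B' : Box} {y : ℕ → ℝ} (hy : B.mem y)
    (v : ℕ) (hs : ∀ e ∈ CL, ∀ a ∈ curvVars e.P e.Z e.Λ v, Ivl.sub (B a) (B' a) = true)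
    (hpos : ∀ e ∈ CL, 0 < (rhoIvl e.ρbar e.P B').lo) :
    curvM CL B v w ≤ curvM CL B' v w := by
  unfold curvM
  refine List.sum_le_sum fun e he => ?_
  exact pairEvalR_curvW_mono hw e.c (curvD_mono e.ρbar e.P e.Z e.Λ v e.U hy (hs e he) (hpos e he)) e.Uinv

/-! ## Slice concavity of the model form -/

/-- the rest (affine minus convex part) along a slice is `e0 + e1 t − e2 t²`. [folklore] -/
theorem rest_update {w : Label → E3} (hw : (support w).Finite) (Aff Cq : List (BondClass × List (Mono × Mat))) {v : ℕ}
    (hA : ∀ a ∈ Aff, mpDegLe a.2 v 1 = true) (hC : ∀ a ∈ Cq, mpDegLe a.2 v 2 = true) (x : ℕ → ℝ) (t : ℝ) :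
    (Aff.map fun a => pairEvalR a.1 (matVal (update x v t) a.2) w).sum - (Cq.map fun a => pairEvalR a.1 (matVal (update x v t) a.2) w).sum
      = ((Aff.map fun a => pairEvalR a.1 (matVal x (mpCoeff a.2 v 0)) w).sum - (Cq.map fun a => pairEvalR a.1 (matVal x (mpCoeff a.2 v 0)) w).sum)
        + ((Aff.map fun a => pairEvalR a.1 (matVal x (mpCoeff a.2 v 1)) w).sum - (Cq.map fun a => pairEvalR a.1 (matVal x (mpCoeff a.2 v 1)) w).sum) * t
        - (Cq.map fun a => pairEvalR a.1 (matVal x (mpCoeff a.2 v 2)) w).sum * t ^ 2 := by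
  have hAff : (Aff.map fun a => pairEvalR a.1 (matVal (update x v t) a.2) w).sum
      = (Aff.map fun a => pairEvalR a.1 (matVal x (mpCoeff a.2 v 0)) w).sum
        + (Aff.map fun a => pairEvalR a.1 (matVal x (mpCoeff a.2 v 1)) w).sum * t := by
    clear hC
    induction Aff with
    | nil => simp
    | cons a Aff ih =>
        simp only [List.map_cons, List.sum_cons]
        rw [ih (fun b hb => hA b (List.mem_cons_of_mem _ hb)),
          pairEvalR_matVal_update hw a.1 a.2 v (mpDegLe_one_two (hA a (List.mem_cons_self ..))) x t,
          mpCoeff_two_of_degLe_one (hA a (List.mem_cons_self ..))]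
        simp [matVal, pairEvalR, bilR]
        ring
  have hCq : (Cq.map fun a => pairEvalR a.1 (matVal (update x v t) a.2) w).sum
      = (Cq.map fun a => pairEvalR a.1 (matVal x (mpCoeff a.2 v 0)) w).sum
        + (Cq.map fun a => pairEvalR a.1 (matVal x (mpCoeff a.2 v 1)) w).sum * t
        + (Cq.map fun a => pairEvalR a.1 (matVal x (mpCoeff a.2 v 2)) w).sum * t ^ 2 := by
    clear hA hAff
    induction Cq with
    | nil => simp
    | cons a Cq ih =>
        simp only [List.map_cons, List.sum_cons]
        rw [ih (fun b hb => hC b (List.mem_cons_of_mem _ hb)),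
          pairEvalR_matVal_update hw a.1 a.2 v (hC a (List.mem_cons_self ..)) x t]
        ring
  rw [hAff, hCq]
  ring

/-- the class part along a slice is the slice sum of the `ω̃`/`ψ̃` terms. [folklore] -/
theorem classPart_update {w : Label → E3} (hw : (support w).Finite) (CL : List ClassDat) {v : ℕ}
    (h : ∀ e ∈ CL, spDegLe e.P v 2 = true ∧ mpDegLe e.Z v 2 = true ∧ mpDegLe e.Λ v 2 = true) (x : ℕ → ℝ) (t : ℝ) :
    (CL.map fun e => classModel e.ρbar e.P e.Z e.Λ e.c (update x v t) w).sum
      = (CL.map fun e => (sliceOmega e.ρbar e.P e.Z e.c v x w).g t + (slicePsi e.ρbar e.P e.Λ e.c v x w).g t).sum := by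
  refine congrArg List.sum (List.map_congr_left fun e he => ?_)
  obtain ⟨h1, h2, h3⟩ := h e he
  exact classModel_update hw e.ρbar e.c h1 h2 h3 x t

/-- unpacking `sliceShapeOK`. [folklore] -/
theorem sliceShapeOK_unpack {CL : List ClassDat} {Aff Cq : List (BondClass × List (Mono × Mat))} {v : ℕ}
    (h : sliceShapeOK CL Aff Cq v = true) :
    (∀ e ∈ CL, spDegLe e.P v 2 = true ∧ mpDegLe e.Z v 2 = true ∧ mpDegLe e.Λ v 2 = true ∧
        matEqB (mmul e.U e.Uinv) oneQ = true) ∧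
      (∀ a ∈ Aff, mpDegLe a.2 v 1 = true) ∧
      (∀ a ∈ Cq, mpDegLe a.2 v 2 = true ∧ mpAllEmpty (mpCoeff a.2 v 2) = true ∧ psd3 (mpSum (mpCoeff a.2 v 2)) = true) := by
  unfold sliceShapeOK at h
  simp only [Bool.and_eq_true, List.all_eq_true] at h
  obtain ⟨⟨hCL, hAff⟩, hCq⟩ := h
  refine ⟨fun e he => ?_, hAff, fun a ha => ?_⟩
  · obtain ⟨⟨⟨h1, h2⟩, h3⟩, h4⟩ := hCL e he
    exact ⟨h1, h2, h3, h4⟩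
  · obtain ⟨⟨h1, h2⟩, h3⟩ := hCq a ha
    exact ⟨h1, h2, h3⟩

/-- concavity of a list sum of concave functions. [folklore] -/
theorem concaveOn_list_sum {ι : Type*} {s : Set ℝ} (hs : Convex ℝ s) (L : List ι) (f : ι → ℝ → ℝ)
    (h : ∀ e ∈ L, ConcaveOn ℝ s (f e)) : ConcaveOn ℝ s (fun t => (L.map fun e => f e t).sum) := by
  induction L with
  | nil => simpa using concaveOn_const (c := (0 : ℝ)) hs
  | cons e L ih =>
      simp only [List.map_cons, List.sum_cons]
      exact (h e (List.mem_cons_self ..)).add (ih fun e' he' => h e' (List.mem_cons_of_mem _ he'))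

/-- **SLICE CONCAVITY OF THE MODEL FORM:** on a box with good slice data for `v`, through any point `x` of the box,
`t ↦ Fmodel(x[v ↦ t])(w) − M_v(w)/2 · t²` is concave on `[B_v.lo, B_v.hi]`. [folklore] -/
theorem concaveOn_Fmodel {w : Label → E3} (hw : (support w).Finite) {CL : List ClassDat}
    {Aff Cq : List (BondClass × List (Mono × Mat))} {B : Box} {v : ℕ} (hok : sliceShapeOK CL Aff Cq v = true)
    (hposB : ∀ e ∈ CL, 0 < (rhoIvl e.ρbar e.P B).lo) {x : ℕ → ℝ} (hx : B.mem x) :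
    ConcaveOn ℝ (Icc ((B v).lo : ℝ) ((B v).hi : ℝ))
      (fun t => Fmodel CL Aff Cq (update x v t) w - curvM CL B v w / 2 * t ^ 2) := by
  obtain ⟨hCL, hAff, hCq⟩ := sliceShapeOK_unpack hok
  set e0 := (Aff.map fun a => pairEvalR a.1 (matVal x (mpCoeff a.2 v 0)) w).sum
    - (Cq.map fun a => pairEvalR a.1 (matVal x (mpCoeff a.2 v 0)) w).sum with he0
  set e1 := (Aff.map fun a => pairEvalR a.1 (matVal x (mpCoeff a.2 v 1)) w).sum
    - (Cq.map fun a => pairEvalR a.1 (matVal x (mpCoeff a.2 v 1)) w).sum with he1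
  set e2 := (Cq.map fun a => pairEvalR a.1 (matVal x (mpCoeff a.2 v 2)) w).sum with he2
  -- the function as (Σ_e [classModel_e − P(W_e)/2 t²]) + (e0 + e1 t − e2 t²)
  have hfun : (fun t => Fmodel CL Aff Cq (update x v t) w - curvM CL B v w / 2 * t ^ 2)
      = fun t => (CL.map fun e => classModel e.ρbar e.P e.Z e.Λ e.c (update x v t) w
          - pairEvalR e.c (fun i j => (curvW (curvD e.ρbar e.P e.Z e.Λ v e.U B) e.Uinv i j : ℝ)) w / 2 * t ^ 2).sum
        + (sliceSum [] e0 e1 e2 t - 0 / 2 * t ^ 2) := by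
    funext t
    have hsplit : ∀ (L : List ClassDat), (L.map fun e => classModel e.ρbar e.P e.Z e.Λ e.c (update x v t) w
          - pairEvalR e.c (fun i j => (curvW (curvD e.ρbar e.P e.Z e.Λ v e.U B) e.Uinv i j : ℝ)) w / 2 * t ^ 2).sum
        = (L.map fun e => classModel e.ρbar e.P e.Z e.Λ e.c (update x v t) w).sum
          - (L.map fun e => pairEvalR e.c (fun i j => (curvW (curvD e.ρbar e.P e.Z e.Λ v e.U B) e.Uinv i j : ℝ)) w).sum
            / 2 * t ^ 2 := by
      intro L; induction L with
      | nil => simp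
      | cons e L ih => simp only [List.map_cons, List.sum_cons, ih]; ring
    rw [hsplit]
    unfold Fmodel curvM
    have hr := rest_update hw Aff Cq hAff (fun a ha => (hCq a ha).1) x t
    rw [← he0, ← he1, ← he2] at hr
    simp only [sliceSum, List.map_nil, List.sum_nil]
    linear_combination hr
  rw [hfun]
  refine ConcaveOn.add ?_ ?_
  · refine concaveOn_list_sum (convex_Icc _ _) CL _ fun e he => ?_
    obtain ⟨h1, h2, h3, h4⟩ := hCL e he
    exact concaveOn_classModel hw e.ρbar e.c h1 h2 h3 h4 (hposB e he) hx
  · refine concaveOn_sliceSum (L := []) (by simp) e0 e1 e2 (M := 0) (by simp) ?_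
    intro t _
    unfold sliceSum2
    simp only [List.map_nil, List.sum_nil, zero_sub, neg_nonpos]
    have : 0 ≤ e2 := by
      rw [he2]
      refine List.sum_nonneg ?_
      intro r hr
      rw [List.mem_map] at hr
      obtain ⟨a, ha, rfl⟩ := hr
      obtain ⟨-, hE, hP⟩ := hCq a ha
      have hM : matVal x (mpCoeff a.2 v 2) = fun i j => (mpSum (mpCoeff a.2 v 2) i j : ℝ) := by
        funext i j; exact matVal_of_allEmpty hE x i j
      rw [hM]
      exact pairEvalR_nonneg_of_psd a.1 (psd3_sound hP) w
    linarith

/-- Anchor of this support file (registered stub of the line skeleton, lead c2): the empty model vanishes. -/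
theorem stub_certModelF : ∀ (y : ℕ → ℝ) (w : Label → EuclideanSpace ℝ (Fin 3)), Fmodel [] [] [] y w = 0 := by
  intro y w; simp [Fmodel]

end Summit.AtomisticToContinuum.Crystallization.Theorems.PhononStabilityCWC.Cert

end
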